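import Summits.NavierStokesRegularity.NavierStokesRegularity.Theorems.EfficiencyFloorRigidExitResonanceOrbit
import Summits.NavierStokesRegularity.NavierStokesRegularity.Theorems.EfficiencyFloorMaximiserSetRigidityOrbitRigidity
import HarnessLib

/-!
# Route `EfficiencyFloor`, support `RigidExit` (stmt-25513) on the `ProductionEfficiencyDecay` ladder (stmt-22866):
# the SCALE parameter of an orbit-valued trajectory is forced by the enstrophy — the self-similar clock

Helper file (`--supports stmt-NavierStokesRegularity-22866`; line `efficiency_floor`). The landed READING of `RigidExit`
(`…RigidExitSaturationExit`, `…MaximiserSetRigidityOrbitRigidity`) leaves of item (i) ORBIT SELECTION the step «a classical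
trajectory inside ONE symmetry orbit `t ↦ λ(t) R(t) m(λ(t) R(t)⁻¹(· − a(t)))` has parameter paths DIFFERENTIABLE at an instant» —
then `MaximiserSetRigidity.ProfileLiouville.no_movingOrbit_solution` (p823448) exhibits `m` as a relative equilibrium and part (b)
gives `False`. This file removes the SCALE direction from that step, by pure bookkeeping:

* `scale_eq_enstrophy_ratio` (§2, static): in any orbit representation `v = l • R (m (l • R⁻¹(· − a)))` (`l > 0`, `Z(m) > 0`) the
  scale is `l = Z(v)/Z(m)` (`Z = ∫|curl ·|²`; the landed `Resonance.integral_curl_sq_orbitSlice`).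
* `hasDerivAt_enstrophy` (§3, BY NAME): along every maximal classical Leray–Hopf rapidly-decaying-datum solution the real
  enstrophy `t ↦ ∫|curl u(t)|²` is differentiable at every `t ∈ (0,T)` (the sharp budget of stmt-25481, read as a statement about
  the function itself).
* `no_movingOrbit_solution_of_orbitForm` (§4, BY NAME): hence in `no_movingOrbit_solution` the hypotheses on the scale path
  (`HasDerivAt lam l' s`, `0 < lam s`) are AUTOMATIC for solutions of the route's class: if on an open time set `S ⊂ (0,T)`, `s ∈ S`,
  the slices have the orbit form `u t = lam t • R t (m (lam t • (R t)⁻¹(· − a t)))` with `lam t > 0`, `R t` linear isometries,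
  `m` a normalised maximiser, and ONLY the Euclidean paths `a`, `R`, `R⁻¹` are assumed differentiable at `s`, then `False`.
  What remains of item (i) is therefore the selection of differentiable ROTATION and TRANSLATION paths (the slice theorem for
  the Euclidean group acting on `H²` profiles), nothing about scaling.
* `inv_sq_eq_of_saturation`, `lt_window_of_saturation`, `eq_clock_of_saturation` (§1, real analysis): under the SATURATED cubic
  law `Z' = K Z³` on `[s,t]`: `Z(t)⁻² = Z(s)⁻² − 2K(t − s)`, so `t − s < (2K)⁻¹ Z(s)⁻²` and `Z(t) = Z(s)/√(1 − 2K Z(s)²(t − s))`.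
* `enstrophy_clock_of_maximiserInterval` (§5, BY NAME, sharp constant `c⋆`, `K = 27c⋆⁴/(128ν³)`): on a MAXIMISER INTERVAL
  `[s,s₁] ⊂ (0,T)` of a solution of the route's class the enstrophy runs on the explicit self-similar clock above, the interval is
  shorter than the would-be blow-up window `W(s) = (64ν³/(27c⋆⁴))·Z(u s)⁻²`, every orbit representation of a slice over a profile
  `m` has scale `λ(σ) = Z(u σ)/Z(m)`, and `λ' = K·Z(u σ)³/Z(m)`, i.e. `λ'/λ³ = K·Z(m)² > 0`: the collapse rate `c′ = λ'/λ³` fed to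
  part (b) by `no_movingOrbit_solution` is the POSITIVE constant `K·Z(m)²` — only the self-similarly COLLAPSING branch of part (b)
  (the Nečas–Růžička–Šverák/Tsai/ESŠ Liouville branch, `c′ > 0`) is ever invoked by `RigidExit`; the steady/expanding branches are idle.

HONEST FRAMING: elementary statements about a HYPOTHETICAL blow-up and about orbit representations; `RigidExit`, clause (a),
`NearMaximiserBoundedAmplification`, `LerayFloorGap`, `ProductionEfficiencyDecay` (stmt-22866) and Navier–Stokes regularity stay
OPEN; no summit statement is proved. [folklore]
-/

-- the problem directory repeats the summit name (`NavierStokesRegularity/NavierStokesRegularity`)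
set_option linter.dupNamespace false

noncomputable section

open Set Filter MeasureTheory Topology Function
open scoped InnerProductSpace RealInnerProductSpace ENNReal NNReal
open Literature.Analysis.FluidPDE

namespace Summit.NavierStokesRegularity.NavierStokesRegularity.Theorems

namespace RigidExit

namespace ScaleClock

open NearMaximiserBoundedAmplification MaximiserSetRigidity.ProfileLiouville Resonance

/-! ## §1 Real analysis: the saturated cubic law integrates to the self-similar clock -/

/-- **Saturated cubic law, integrated.** If `Z > 0` on `[s,t]` with `Z' = K·Z³` there, then `Z(t)⁻² = Z(s)⁻² − 2K(t − s)`
(`(Z⁻²)' = −2K`). [folklore] -/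
theorem inv_sq_eq_of_saturation {Zr : ℝ → ℝ} {K s t : ℝ} (hst : s ≤ t)
    (hpos : ∀ τ ∈ Icc s t, 0 < Zr τ) (hder : ∀ τ ∈ Icc s t, HasDerivAt Zr (K * Zr τ ^ 3) τ) :
    (Zr t)⁻¹ ^ 2 = (Zr s)⁻¹ ^ 2 - 2 * K * (t - s) := by
  have hF : ∀ τ ∈ uIcc s t, HasDerivAt (fun σ => (Zr σ)⁻¹ ^ 2) (-2 * K) τ := by
    intro τ hτ
    rw [uIcc_of_le hst] at hτ
    have hZ := hpos τ hτ
    have h1 := ((hder τ hτ).inv hZ.ne').pow 2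
    refine h1.congr_deriv ?_
    have hZne : Zr τ ≠ 0 := hZ.ne'
    norm_num
    field_simp
  have hint : ∫ τ in s..t, (-2 * K : ℝ) = (Zr t)⁻¹ ^ 2 - (Zr s)⁻¹ ^ 2 :=
    intervalIntegral.integral_eq_sub_of_hasDerivAt hF (by simp)
  rw [intervalIntegral.integral_const, smul_eq_mul] at hint
  linarith

/-- **A saturated interval is shorter than the would-be blow-up window**: under the hypotheses of `inv_sq_eq_of_saturation`,
`2K·Z(s)²·(t − s) < 1` (the right-hand side `Z(t)⁻²` is positive). [folklore] -/
theorem lt_window_of_saturation {Zr : ℝ → ℝ} {K s t : ℝ} (hst : s ≤ t)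
    (hpos : ∀ τ ∈ Icc s t, 0 < Zr τ) (hder : ∀ τ ∈ Icc s t, HasDerivAt Zr (K * Zr τ ^ 3) τ) :
    2 * K * Zr s ^ 2 * (t - s) < 1 := by
  have h := inv_sq_eq_of_saturation hst hpos hder
  have hZt : 0 < (Zr t)⁻¹ ^ 2 := pow_pos (inv_pos.2 (hpos t ⟨hst, le_rfl⟩)) 2
  have hZs : 0 < Zr s := hpos s ⟨le_rfl, hst⟩
  rw [h] at hZt
  have h2 : 2 * K * (t - s) < (Zr s)⁻¹ ^ 2 := by linarith
  have h3 : 2 * K * Zr s ^ 2 * (t - s) = (2 * K * (t - s)) * Zr s ^ 2 := by ring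
  rw [h3]
  calc (2 * K * (t - s)) * Zr s ^ 2 < (Zr s)⁻¹ ^ 2 * Zr s ^ 2 :=
        mul_lt_mul_of_pos_right h2 (pow_pos hZs 2)
    _ = 1 := by field_simp

/-- **The self-similar clock.** Under the hypotheses of `inv_sq_eq_of_saturation`,
`Z(t) = Z(s) / √(1 − 2K·Z(s)²·(t − s))`. [folklore] -/
theorem eq_clock_of_saturation {Zr : ℝ → ℝ} {K s t : ℝ} (hst : s ≤ t)
    (hpos : ∀ τ ∈ Icc s t, 0 < Zr τ) (hder : ∀ τ ∈ Icc s t, HasDerivAt Zr (K * Zr τ ^ 3) τ) :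
    Zr t = Zr s / Real.sqrt (1 - 2 * K * Zr s ^ 2 * (t - s)) := by
  have h := inv_sq_eq_of_saturation hst hpos hder
  have hw := lt_window_of_saturation hst hpos hder
  have hZt : 0 < Zr t := hpos t ⟨hst, le_rfl⟩
  have hZs : 0 < Zr s := hpos s ⟨le_rfl, hst⟩
  have hD : 0 < 1 - 2 * K * Zr s ^ 2 * (t - s) := by linarith
  -- `Z(t)² · (1 − 2K Z(s)² (t−s)) = Z(s)²`
  have hsq : Zr t ^ 2 * (1 - 2 * K * Zr s ^ 2 * (t - s)) = Zr s ^ 2 := by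
    have h1 : (Zr t)⁻¹ ^ 2 * (Zr t ^ 2 * Zr s ^ 2) = ((Zr s)⁻¹ ^ 2 - 2 * K * (t - s)) * (Zr t ^ 2 * Zr s ^ 2) := by
      rw [h]
    field_simp at h1
    nlinarith [h1, hZt, hZs]
  have hsqrt : Real.sqrt (1 - 2 * K * Zr s ^ 2 * (t - s)) ≠ 0 := (Real.sqrt_pos.2 hD).ne'
  rw [eq_div_iff hsqrt]
  have h3 : (Zr t * Real.sqrt (1 - 2 * K * Zr s ^ 2 * (t - s))) ^ 2 = Zr s ^ 2 := by
    rw [mul_pow, Real.sq_sqrt hD.le, hsq]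
  have h4 : 0 ≤ Zr t * Real.sqrt (1 - 2 * K * Zr s ^ 2 * (t - s)) := mul_nonneg hZt.le (Real.sqrt_nonneg _)
  nlinarith [sq_nonneg (Zr t * Real.sqrt (1 - 2 * K * Zr s ^ 2 * (t - s)) - Zr s),
    sq_nonneg (Zr t * Real.sqrt (1 - 2 * K * Zr s ^ 2 * (t - s)) + Zr s), h3, h4, hZs]

/-! ## §2 Static: the scale of an orbit representation is the enstrophy ratio -/

/-- **Scale = enstrophy ratio.** If `v = l • R (m (l • R⁻¹(· − a)))` with `l > 0`, `R` a linear isometry and `Z(m) = ∫|curl m|² > 0`,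
then `l = Z(v)/Z(m)`. [folklore] -/
theorem scale_eq_enstrophy_ratio (m : EuclideanSpace ℝ (Fin 3) → EuclideanSpace ℝ (Fin 3)) (a : EuclideanSpace ℝ (Fin 3))
    (R : EuclideanSpace ℝ (Fin 3) ≃ₗᵢ[ℝ] EuclideanSpace ℝ (Fin 3)) {l : ℝ} (hl : 0 < l)
    (hZm : 0 < ∫ x, ‖curl m x‖ ^ 2) :
    l = (∫ x, ‖curl (fun x => l • R (m (l • R.symm (x - a)))) x‖ ^ 2) / ∫ x, ‖curl m x‖ ^ 2 := by
  rw [integral_curl_sq_orbitSlice m a R hl]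
  field_simp

/-- The same for a slice GIVEN as a function equal to an orbit representation. [folklore] -/
theorem scale_eq_enstrophy_ratio' {v m : EuclideanSpace ℝ (Fin 3) → EuclideanSpace ℝ (Fin 3)} {a : EuclideanSpace ℝ (Fin 3)}
    {R : EuclideanSpace ℝ (Fin 3) ≃ₗᵢ[ℝ] EuclideanSpace ℝ (Fin 3)} {l : ℝ} (hl : 0 < l)
    (hZm : 0 < ∫ x, ‖curl m x‖ ^ 2) (hv : v = fun x => l • R (m (l • R.symm (x - a)))) :
    l = (∫ x, ‖curl v x‖ ^ 2) / ∫ x, ‖curl m x‖ ^ 2 := by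
  rw [hv]
  exact scale_eq_enstrophy_ratio m a R hl hZm

/-! ## §3 BY NAME: the real enstrophy of a solution of the route's class is differentiable on `(0,T)` -/

/-- **Differentiability of the enstrophy.** Along every maximal classical solution on `[0,T)` that is Leray–Hopf from a rapidly
decaying datum, the function `t ↦ ∫|curl u(t)|²` has a derivative at every `t ∈ (0,T)`, namely the budget's
`D t = 2S(t) − 2ν·Pal(t)` (stmt-25481 / stmt-22995 read as a statement about the function itself: the budget's `Zr` agrees with
it on the open set `(0,T)`). [cite: RobinsonRodrigoSadowski2016, (6.7)] -/
theorem hasDerivAt_enstrophy {ν T : ℝ} (hν : 0 < ν) (hT : 0 < T)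
    {u : ℝ → EuclideanSpace ℝ (Fin 3) → EuclideanSpace ℝ (Fin 3)} {p : ℝ → EuclideanSpace ℝ (Fin 3) → ℝ}
    (hmax : IsMaximalSmoothSolution ν 0 u p T) (hLH : IsLerayHopfOn T ν 0 (u 0) u) (hdec : HasRapidSpatialDecay (u 0)) :
    ∀ t ∈ Ioo 0 T, HasDerivAt (fun τ => ∫ x, ‖curl (u τ) x‖ ^ 2)
      (2 * (∫ x, ⟪curl (u t) x, fderiv ℝ (u t) x (curl (u t) x)⟫_ℝ) -
        2 * ν * (∫ x, frobeniusNormSq (fderiv ℝ (curl (u t)) x))) t := by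
  intro t ht
  obtain ⟨c, -, hbud⟩ := exists_budget_saturated_iff_normalisedMaximiser
  obtain ⟨Zr, D, hZD, -⟩ := hbud ν T hν hT u p hmax hLH hdec
  obtain ⟨-, -, -, -, hder, hD, -⟩ := hZD t ht
  rw [hD] at hder
  refine hder.congr_of_eventuallyEq ?_
  filter_upwards [isOpen_Ioo.mem_nhds ht] with τ hτ
  exact ((hZD τ hτ).2.2.2.1).symm

/-- **Differentiability of the enstrophy** (`DifferentiableAt` form). [folklore] -/
theorem differentiableAt_enstrophy {ν T : ℝ} (hν : 0 < ν) (hT : 0 < T)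
    {u : ℝ → EuclideanSpace ℝ (Fin 3) → EuclideanSpace ℝ (Fin 3)} {p : ℝ → EuclideanSpace ℝ (Fin 3) → ℝ}
    (hmax : IsMaximalSmoothSolution ν 0 u p T) (hLH : IsLerayHopfOn T ν 0 (u 0) u) (hdec : HasRapidSpatialDecay (u 0)) :
    ∀ t ∈ Ioo 0 T, DifferentiableAt ℝ (fun τ => ∫ x, ‖curl (u τ) x‖ ^ 2) t :=
  fun t ht => (hasDerivAt_enstrophy hν hT hmax hLH hdec t ht).differentiableAt

/-! ## §4 BY NAME: `no_movingOrbit_solution` with the scale path's differentiability DISCHARGED -/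

/-- **No moving-orbit solution in the route's class — scale hypotheses removed.** Let `m` be a normalised maximiser
(`S(m) = c·Z^{3/4}·Pal^{3/4}`, `Pal = (81c⁴/(256ν⁴))Z³`, `Z(m) > 0`, admissible; `c > 0`). If a maximal classical Leray–Hopf
rapidly-decaying-datum solution `u` on `[0,T)` has, on an open time set `S ⊂ (0,T)` containing `s`, the ORBIT FORM
`u t x = lam t • R t (m (lam t • (R t)⁻¹ (x − a t)))` with `lam t > 0` and `R t` linear isometries, where the translation path `a`
and the operator paths `t ↦ R t`, `t ↦ (R t)⁻¹` are differentiable at `s`, then `False` — the scale path `lam` is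
`Z(u ·)/Z(m)` (§2), differentiable at `s` by §3, so `ProfileLiouville.no_movingOrbit_solution` applies and contradicts part (b)
(`ProfileLiouville.partB_holds`). [folklore] -/
theorem no_movingOrbit_solution_of_orbitForm (c ν T : ℝ) (hc : 0 < c) (hν : 0 < ν) (hT : 0 < T)
    (m : EuclideanSpace ℝ (Fin 3) → EuclideanSpace ℝ (Fin 3))
    (hm : ((ContDiff ℝ (⊤ : ℕ∞) m ∧ Literature.Analysis.FluidPDE.VectorCalculus.IsDivFree m ∧ (∫⁻ x, ‖iteratedFDeriv ℝ 0
      m x‖ₑ ^ 2 < ⊤) ∧ (∫⁻ x, ‖iteratedFDeriv ℝ 1 m x‖ₑ ^ 2 < ⊤) ∧ (∫⁻ x, ‖iteratedFDeriv ℝ 2 m x‖ₑ ^ 2 < ⊤))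
      ∧ 0 < (∫ x, ‖Literature.Analysis.FluidPDE.curl m x‖ ^ 2) ∧ (∫ x, ⟪Literature.Analysis.FluidPDE.curl m x,
      fderiv ℝ m x (Literature.Analysis.FluidPDE.curl m x)⟫_ℝ) = c * (∫ x, ‖Literature.Analysis.FluidPDE.curl
      m x‖ ^ 2) ^ (3 / 4 : ℝ) * (∫ x, Literature.Analysis.FluidPDE.frobeniusNormSq (fderiv ℝ
      (Literature.Analysis.FluidPDE.curl m) x)) ^ (3 / 4 : ℝ) ∧ (∫ x,
      Literature.Analysis.FluidPDE.frobeniusNormSq (fderiv ℝ (Literature.Analysis.FluidPDE.curl m) x)) = 81 *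
      c ^ 4 / (256 * ν ^ 4) * (∫ x, ‖Literature.Analysis.FluidPDE.curl m x‖ ^ 2) ^ 3))
    {u : ℝ → EuclideanSpace ℝ (Fin 3) → EuclideanSpace ℝ (Fin 3)} {p : ℝ → EuclideanSpace ℝ (Fin 3) → ℝ}
    (hmax : IsMaximalSmoothSolution ν 0 u p T) (hLH : IsLerayHopfOn T ν 0 (u 0) u) (hdec : HasRapidSpatialDecay (u 0))
    {S : Set ℝ} (hS : IsOpen S) (hST : S ⊆ Ioo 0 T) {s : ℝ} (hs : s ∈ S)
    (lam : ℝ → ℝ) (a : ℝ → EuclideanSpace ℝ (Fin 3))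
    (R : ℝ → (EuclideanSpace ℝ (Fin 3) ≃ₗᵢ[ℝ] EuclideanSpace ℝ (Fin 3)))
    {adot : EuclideanSpace ℝ (Fin 3)} {Rd Rd' : EuclideanSpace ℝ (Fin 3) →L[ℝ] EuclideanSpace ℝ (Fin 3)}
    (ha : HasDerivAt a adot s)
    (hRc : HasDerivAt (fun t => ((R t).toContinuousLinearEquiv : EuclideanSpace ℝ (Fin 3) →L[ℝ] EuclideanSpace ℝ (Fin 3))) Rd s)
    (hRc' : HasDerivAt (fun t => ((R t).symm.toContinuousLinearEquiv :
      EuclideanSpace ℝ (Fin 3) →L[ℝ] EuclideanSpace ℝ (Fin 3))) Rd' s)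
    (hlpos : ∀ t ∈ S, 0 < lam t)
    (hu : ∀ t ∈ S, u t = fun x => lam t • R t (m (lam t • (R t).symm (x - a t)))) : False := by
  have hZm : 0 < ∫ x, ‖curl m x‖ ^ 2 := hm.2.1
  -- the scale path is the enstrophy ratio on `S`
  have hlam : ∀ t ∈ S, lam t = (∫ x, ‖curl (u t) x‖ ^ 2) / ∫ x, ‖curl m x‖ ^ 2 := fun t ht =>
    scale_eq_enstrophy_ratio' (hlpos t ht) hZm (hu t ht)
  -- hence differentiable at `s`
  have hZd := hasDerivAt_enstrophy hν hT hmax hLH hdec s (hST hs)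
  set D : ℝ := 2 * (∫ x, ⟪curl (u s) x, fderiv ℝ (u s) x (curl (u s) x)⟫_ℝ) -
    2 * ν * (∫ x, frobeniusNormSq (fderiv ℝ (curl (u s)) x)) with hDdef
  have hlamd : HasDerivAt lam (D / ∫ x, ‖curl m x‖ ^ 2) s := by
    have h1 : HasDerivAt (fun τ => (∫ x, ‖curl (u τ) x‖ ^ 2) / ∫ x, ‖curl m x‖ ^ 2) (D / ∫ x, ‖curl m x‖ ^ 2) s :=
      hZd.div_const _
    refine h1.congr_of_eventuallyEq ?_
    filter_upwards [hS.mem_nhds hs] with τ hτ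
    exact hlam τ hτ
  have hcl : IsClassicalNSSolutionOn S ν 0 u p :=
    hmax.isClassicalNSSolutionOn.mono (fun t ht => ⟨(hST ht).1.le, (hST ht).2⟩) hS.uniqueDiffOn
  refine no_movingOrbit_solution c ν hc hν m hm hS hs hcl lam a
    (fun t => ((R t).toContinuousLinearEquiv : EuclideanSpace ℝ (Fin 3) →L[ℝ] EuclideanSpace ℝ (Fin 3)))
    (fun t => ((R t).symm.toContinuousLinearEquiv : EuclideanSpace ℝ (Fin 3) →L[ℝ] EuclideanSpace ℝ (Fin 3)))
    hlamd (hlpos s hs) ha hRc hRc' (fun t _ v => ?_) (fun t _ v w => ?_) (R s) (fun v => ?_) (fun v => ?_) ?_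
  · simp
  · simp [LinearIsometryEquiv.inner_map_map]
  · simp
  · simp
  · intro t ht x
    rw [hu t ht]
    simp

/-! ## §5 BY NAME: the self-similar clock on a maximiser interval, and the collapse rate `λ'/λ³ = K·Z(m)²` -/

/-- **The enstrophy clock on a maximiser interval** (sharp constant `c⋆`, `K = 27c⋆⁴/(128ν³)`). Along every maximal classical
Leray–Hopf rapidly-decaying-datum solution, if all slices `u(σ)`, `σ ∈ [s,s₁]` (`0 < s < s₁ < T`), are normalised maximisers, then
for every profile `m` with `Z(m) > 0` and every `σ ∈ [s,s₁]`:
(1) `Z(u σ)⁻² = Z(u s)⁻² − 2K(σ − s)`; (2) `σ − s < W(s) = (64ν³/(27c⋆⁴))·Z(u s)⁻²`; (3) `Z(u σ) = Z(u s)/√(1 − 2K Z(u s)²(σ − s))`;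
(4) every orbit representation `u σ = l • R (m (l • R⁻¹(· − a)))`, `l > 0`, has `l = Z(u σ)/Z(m)`;
(5) the scale path `λ = Z(u ·)/Z(m)` has `λ'(σ) = K·Z(u σ)³/Z(m)` and `λ'(σ)/λ(σ)³ = K·Z(m)²` (a positive constant: the collapse
rate fed to part (b) is that of a self-similarly COLLAPSING profile). [cite: LuDoering2008, eq. (6)] -/
theorem enstrophy_clock_of_maximiserInterval :
    ∃ c : ℝ, (0 < c ∧ (∀ v : EuclideanSpace ℝ (Fin 3) → EuclideanSpace ℝ (Fin 3), (ContDiff ℝ (⊤ : ℕ∞) v ∧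
      VectorCalculus.IsDivFree v ∧ (∫⁻ x, ‖iteratedFDeriv ℝ 0 v x‖ₑ ^ 2 < ⊤) ∧ (∫⁻ x, ‖iteratedFDeriv ℝ 1 v x‖ₑ ^ 2 < ⊤) ∧
      (∫⁻ x, ‖iteratedFDeriv ℝ 2 v x‖ₑ ^ 2 < ⊤)) → (∫ x, ⟪curl v x, fderiv ℝ v x (curl v x)⟫_ℝ) ≤
      c * (∫ x, ‖curl v x‖ ^ 2) ^ (3 / 4 : ℝ) * (∫ x, frobeniusNormSq (fderiv ℝ (curl v) x)) ^ (3 / 4 : ℝ)) ∧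
      ∀ c' : ℝ, (∀ w : EuclideanSpace ℝ (Fin 3) → EuclideanSpace ℝ (Fin 3), (ContDiff ℝ (⊤ : ℕ∞) w ∧
      VectorCalculus.IsDivFree w ∧ (∫⁻ x, ‖iteratedFDeriv ℝ 0 w x‖ₑ ^ 2 < ⊤) ∧ (∫⁻ x, ‖iteratedFDeriv ℝ 1 w x‖ₑ ^ 2 < ⊤) ∧
      (∫⁻ x, ‖iteratedFDeriv ℝ 2 w x‖ₑ ^ 2 < ⊤)) → (∫ x, ⟪curl w x, fderiv ℝ w x (curl w x)⟫_ℝ) ≤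
      c' * (∫ x, ‖curl w x‖ ^ 2) ^ (3 / 4 : ℝ) * (∫ x, frobeniusNormSq (fderiv ℝ (curl w) x)) ^ (3 / 4 : ℝ)) → c ≤ c') ∧
      ∀ (ν T : ℝ), 0 < ν → 0 < T →
      ∀ (u : ℝ → EuclideanSpace ℝ (Fin 3) → EuclideanSpace ℝ (Fin 3)) (p : ℝ → EuclideanSpace ℝ (Fin 3) → ℝ),
      IsMaximalSmoothSolution ν 0 u p T → IsLerayHopfOn T ν 0 (u 0) u → HasRapidSpatialDecay (u 0) →
      ∀ s s₁ : ℝ, 0 < s → s < s₁ → s₁ < T → (∀ σ ∈ Icc s s₁, ((ContDiff ℝ (⊤ : ℕ∞) (u σ) ∧ VectorCalculus.IsDivFree (u σ) ∧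
        (∫⁻ x, ‖iteratedFDeriv ℝ 0 (u σ) x‖ₑ ^ 2 < ⊤) ∧ (∫⁻ x, ‖iteratedFDeriv ℝ 1 (u σ) x‖ₑ ^ 2 < ⊤) ∧
        (∫⁻ x, ‖iteratedFDeriv ℝ 2 (u σ) x‖ₑ ^ 2 < ⊤)) ∧ 0 < (∫ x, ‖curl (u σ) x‖ ^ 2) ∧
        (∫ x, ⟪curl (u σ) x, fderiv ℝ (u σ) x (curl (u σ) x)⟫_ℝ) = c * (∫ x, ‖curl (u σ) x‖ ^ 2) ^ (3 / 4 : ℝ) *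
          (∫ x, frobeniusNormSq (fderiv ℝ (curl (u σ)) x)) ^ (3 / 4 : ℝ) ∧
        (∫ x, frobeniusNormSq (fderiv ℝ (curl (u σ)) x)) = 81 * c ^ 4 / (256 * ν ^ 4) * (∫ x, ‖curl (u σ) x‖ ^ 2) ^ 3)) →
      ∀ m : EuclideanSpace ℝ (Fin 3) → EuclideanSpace ℝ (Fin 3), 0 < (∫ x, ‖curl m x‖ ^ 2) →
      ∀ σ ∈ Icc s s₁,
        (∫ x, ‖curl (u σ) x‖ ^ 2)⁻¹ ^ 2 = (∫ x, ‖curl (u s) x‖ ^ 2)⁻¹ ^ 2 - 2 * (27 * c ^ 4 / (128 * ν ^ 3)) * (σ - s) ∧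
        σ - s < 64 * ν ^ 3 / (27 * c ^ 4) * (∫ x, ‖curl (u s) x‖ ^ 2)⁻¹ ^ 2 ∧
        (∫ x, ‖curl (u σ) x‖ ^ 2) = (∫ x, ‖curl (u s) x‖ ^ 2) /
          Real.sqrt (1 - 2 * (27 * c ^ 4 / (128 * ν ^ 3)) * (∫ x, ‖curl (u s) x‖ ^ 2) ^ 2 * (σ - s)) ∧
        (∀ (a : EuclideanSpace ℝ (Fin 3)) (R : EuclideanSpace ℝ (Fin 3) ≃ₗᵢ[ℝ] EuclideanSpace ℝ (Fin 3)) (l : ℝ), 0 < l →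
          (u σ = fun x => l • R (m (l • R.symm (x - a)))) → l = (∫ x, ‖curl (u σ) x‖ ^ 2) / ∫ x, ‖curl m x‖ ^ 2) ∧
        HasDerivAt (fun τ => (∫ x, ‖curl (u τ) x‖ ^ 2) / ∫ x, ‖curl m x‖ ^ 2)
          ((27 * c ^ 4 / (128 * ν ^ 3)) * (∫ x, ‖curl (u σ) x‖ ^ 2) ^ 3 / ∫ x, ‖curl m x‖ ^ 2) σ ∧
        ((27 * c ^ 4 / (128 * ν ^ 3)) * (∫ x, ‖curl (u σ) x‖ ^ 2) ^ 3 / ∫ x, ‖curl m x‖ ^ 2) /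
            ((∫ x, ‖curl (u σ) x‖ ^ 2) / ∫ x, ‖curl m x‖ ^ 2) ^ 3 = (27 * c ^ 4 / (128 * ν ^ 3)) * (∫ x, ‖curl m x‖ ^ 2) ^ 2 ∧
        0 < (27 * c ^ 4 / (128 * ν ^ 3)) * (∫ x, ‖curl m x‖ ^ 2) ^ 2 := by
  obtain ⟨c, hsharp, hbud⟩ := exists_budget_saturated_iff_normalisedMaximiser
  refine ⟨c, hsharp, fun ν T hν hT u p hmax hLH hdec s s₁ hs0 hss₁ hs₁T hNM m hZm σ hσ => ?_⟩
  obtain ⟨Zr, D, hZD, hsat⟩ := hbud ν T hν hT u p hmax hLH hdec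
  have hc : 0 < c := hsharp.1
  set K : ℝ := 27 * c ^ 4 / (128 * ν ^ 3) with hK
  have hKpos : 0 < K := by positivity
  have hIoo : ∀ τ ∈ Icc s s₁, τ ∈ Ioo 0 T := fun τ hτ => ⟨hs0.trans_le hτ.1, hτ.2.trans_lt hs₁T⟩
  -- the budget dictionary on `[s,s₁]`
  have hZeq : ∀ τ ∈ Icc s s₁, Zr τ = ∫ x, ‖curl (u τ) x‖ ^ 2 := fun τ hτ => (hZD τ (hIoo τ hτ)).2.2.2.1
  have hpos : ∀ τ ∈ Icc s s₁, 0 < Zr τ := fun τ hτ => by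
    rw [hZeq τ hτ]; exact (hNM τ hτ).2.1
  -- saturation: `Z' = K Z³` on `[s,s₁]` (pointwise dictionary)
  have hder : ∀ τ ∈ Icc s s₁, HasDerivAt Zr (K * Zr τ ^ 3) τ := fun τ hτ => by
    have h := (hZD τ (hIoo τ hτ)).2.2.2.2.1
    have hD : D τ = K * Zr τ ^ 3 := by rw [hK]; exact (hsat τ (hIoo τ hτ)).2 (hNM τ hτ)
    rwa [hD] at h
  have hsub : Icc s σ ⊆ Icc s s₁ := Icc_subset_Icc_right hσ.2
  have hpos' : ∀ τ ∈ Icc s σ, 0 < Zr τ := fun τ hτ => hpos τ (hsub hτ)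
  have hder' : ∀ τ ∈ Icc s σ, HasDerivAt Zr (K * Zr τ ^ 3) τ := fun τ hτ => hder τ (hsub hτ)
  have h1 := inv_sq_eq_of_saturation hσ.1 hpos' hder'
  have h2 := lt_window_of_saturation hσ.1 hpos' hder'
  have h3 := eq_clock_of_saturation hσ.1 hpos' hder'
  rw [hZeq s ⟨le_rfl, hss₁.le⟩, hZeq σ hσ] at h1 h3
  rw [hZeq s ⟨le_rfl, hss₁.le⟩] at h2
  have hZs : 0 < ∫ x, ‖curl (u s) x‖ ^ 2 := (hNM s ⟨le_rfl, hss₁.le⟩).2.1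
  have hZσ : 0 < ∫ x, ‖curl (u σ) x‖ ^ 2 := (hNM σ hσ).2.1
  refine ⟨h1, ?_, h3, fun a R l hl huσ => scale_eq_enstrophy_ratio' hl hZm huσ, ?_, ?_, by positivity⟩
  · -- `σ − s < W(s)`: from `2K Z(s)² (σ − s) < 1`
    have hW : 64 * ν ^ 3 / (27 * c ^ 4) * (∫ x, ‖curl (u s) x‖ ^ 2)⁻¹ ^ 2 = (2 * K * (∫ x, ‖curl (u s) x‖ ^ 2) ^ 2)⁻¹ := by
      rw [hK]; field_simp; ring
    have hA : 0 < 2 * K * (∫ x, ‖curl (u s) x‖ ^ 2) ^ 2 := by positivity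
    rw [hW, inv_eq_one_div, lt_div_iff₀ hA]
    calc (σ - s) * (2 * K * (∫ x, ‖curl (u s) x‖ ^ 2) ^ 2) = 2 * K * (∫ x, ‖curl (u s) x‖ ^ 2) ^ 2 * (σ - s) := by ring
      _ < 1 := h2
  · -- derivative of the scale path at `σ`
    have hd : HasDerivAt (fun τ => ∫ x, ‖curl (u τ) x‖ ^ 2) (K * (∫ x, ‖curl (u σ) x‖ ^ 2) ^ 3) σ := by
      have h := hder σ hσ
      rw [hZeq σ hσ] at h
      refine h.congr_of_eventuallyEq ?_
      filter_upwards [isOpen_Ioo.mem_nhds (hIoo σ hσ)] with τ hτ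
      exact ((hZD τ hτ).2.2.2.1).symm
    exact hd.div_const _
  · field_simp
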